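import Summits.Ventures.PercRepro.MSTightBipartition

/-!
# Lemma A⁺, part 2: the case analysis

`MSTightBipartition.lean` sets up the collisions of an up/down bipartition `(F₁, G \ F₁)` of a
tight family `G` and proves the collision generators (a) (a′) (b) (b′) (c) (c′) of
proofs/MINE1-theoremS.md, Addendum 18. This file runs the case analysis: a twin-free up/down
bipartition has two distinct collisions (`exists_two_collisions`), hence
`2 ≤ |(F₁ \\ (G \ F₁)) ∩ ((G \ F₁) \\ G ∪ G \\ F₁)|` (`two_le_card_collisions`, **Lemma A⁺**).

The argument: by (d) either every ⊆-minimal member of `F₁` has a nonempty part outside the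
addable part `Rstar G` (Case I) or every ⊆-maximal member of `G \ F₁` misses part of `Rstar G`
(Case II). In Case I take a minimal `m`; if its non-addable part is not a single twin class,
(b) gives two collisions; if it is the class of `a`, twin-freeness at `a` gives a member of `F₁`
avoiding `a` (then a second minimal member with a different class, and (c) twice) or a member of
`G \ F₁` containing `a` (then a maximal member `s` above it whose missing addable part is a single
class `cls G b`, the collision `m \ s ∋ b`, and twin-freeness at `b` gives a second collision
avoiding `b` by (a′) or (c′)). Case II is the mirror image.
-/

namespace PercRepro.MSTight

open Finset
open scoped FinsetFamily symmDiff

variable {α : Type*} [DecidableEq α] [Fintype α]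

section Tight

variable {G F₁ : Finset (Finset α)}

/-- **Two distinct collisions from a minimal member whose non-addable part is not a single
class.** -/
theorem exists_two_collisions_of_not_cls (hG : Tight G) (hsub : F₁ ⊆ G)
    {m : Finset α} (hm : m ∈ F₁) (hmin : ∀ t ∈ F₁, t ⊆ m → t = m) {a : α}
    (ha : a ∈ m \ Rstar G) (hne : m \ Rstar G ≠ cls G a) :
    ∃ E₁ ∈ (F₁ \\ (G \ F₁)) ∩ ((G \ F₁) \\ G ∪ G \\ F₁), ∃ E₂ ∈ (F₁ \\ (G \ F₁)) ∩ ((G \ F₁) \\ G ∪ G \\ F₁), E₁ ≠ E₂ := by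
  have hx : TwinClosed G (m \ Rstar G) := (twinClosed_of_mem (hsub hm)).sdiff (twinClosed_Rstar G)
  have hcls : cls G a ⊆ m \ Rstar G := cls_subset_of_twinClosed hx ha
  obtain ⟨a', ha'x, ha'a⟩ : ∃ a' ∈ m \ Rstar G, a' ∉ cls G a := by
    by_contra h
    exact hne (subset_antisymm (fun a' ha' => by_contra fun h' => h ⟨a', ha', h'⟩) hcls)
  have hcls' : cls G a' ⊆ m \ Rstar G := cls_subset_of_twinClosed hx ha'x
  have haa' : a ∉ cls G a' := fun h => ha'a (mem_cls.2 (mem_cls.1 h).symm)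
  refine ⟨cls G a, collision_of_minimal_of_ssubset hG hsub hm hmin (twinClosed_cls G a) hcls
    ⟨a, self_mem_cls G a⟩ (fun h => ha'a (h ▸ ha'x)), cls G a',
    collision_of_minimal_of_ssubset hG hsub hm hmin (twinClosed_cls G a') hcls'
    ⟨a', self_mem_cls G a'⟩ (fun h => haa' (h ▸ ha)), ?_⟩
  intro h
  exact haa' (h ▸ self_mem_cls G a)

/-- **Two distinct collisions from a maximal member whose missing addable part is not a single
class.** -/
theorem exists_two_collisions_of_not_cls' (hsub : F₁ ⊆ G)
    (hup : ∀ t ∈ F₁, ∀ s ∈ G, t ⊆ s → s ∈ F₁)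
    {s : Finset α} (hsG : s ∈ G) (hs : s ∉ F₁) (hmax : ∀ t ∈ G, t ∉ F₁ → s ⊆ t → t = s) {b : α}
    (hb : b ∈ Rstar G \ s) (hne : Rstar G \ s ≠ cls G b) :
    ∃ E₁ ∈ (F₁ \\ (G \ F₁)) ∩ ((G \ F₁) \\ G ∪ G \\ F₁), ∃ E₂ ∈ (F₁ \\ (G \ F₁)) ∩ ((G \ F₁) \\ G ∪ G \\ F₁), E₁ ≠ E₂ := by
  have hy : TwinClosed G (Rstar G \ s) := (twinClosed_Rstar G).sdiff (twinClosed_of_mem hsG)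
  have hcls : cls G b ⊆ Rstar G \ s := cls_subset_of_twinClosed hy hb
  obtain ⟨b', hb'y, hb'b⟩ : ∃ b' ∈ Rstar G \ s, b' ∉ cls G b := by
    by_contra h
    exact hne (subset_antisymm (fun b' hb' => by_contra fun h' => h ⟨b', hb', h'⟩) hcls)
  have hcls' : cls G b' ⊆ Rstar G \ s := cls_subset_of_twinClosed hy hb'y
  have hbb' : b ∉ cls G b' := fun h => hb'b (mem_cls.2 (mem_cls.1 h).symm)
  refine ⟨cls G b, collision_of_maximal_of_ssubset hsub hup hsG hs hmax (twinClosed_cls G b) hcls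
    ⟨b, self_mem_cls G b⟩ (fun h => hb'b (h ▸ hb'y)), cls G b',
    collision_of_maximal_of_ssubset hsub hup hsG hs hmax (twinClosed_cls G b') hcls'
    ⟨b', self_mem_cls G b'⟩ (fun h => hbb' (h ▸ hb)), ?_⟩
  intro h
  exact hbb' (h ▸ self_mem_cls G b)

/-- **Lemma A⁺ (existential form).** A twin-free up/down bipartition of a tight family has two
distinct collisions. -/
theorem exists_two_collisions (hG : Tight G) (hsub : F₁ ⊆ G) (hne₁ : F₁.Nonempty)
    (hne₀ : (G \ F₁).Nonempty) (hup : ∀ t ∈ F₁, ∀ s ∈ G, t ⊆ s → s ∈ F₁)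
    (htf : ∀ a : α, ∃ t ∈ G, ¬ (t ∈ F₁ ↔ a ∈ t)) :
    ∃ E₁ ∈ (F₁ \\ (G \ F₁)) ∩ ((G \ F₁) \\ G ∪ G \\ F₁), ∃ E₂ ∈ (F₁ \\ (G \ F₁)) ∩ ((G \ F₁) \\ G ∪ G \\ F₁), E₁ ≠ E₂ := by
  by_cases hI : ∀ m ∈ F₁, (∀ t ∈ F₁, t ⊆ m → t = m) → (m \ Rstar G).Nonempty
  · -- Case I: every ⊆-minimal member of `F₁` has a nonempty non-addable part
    obtain ⟨m, hm, hmin⟩ := exists_minimal_subset hne₁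
    obtain ⟨a, ha⟩ := hI m hm hmin
    by_cases hsingle : m \ Rstar G = cls G a
    · obtain ⟨t, htG, htiff⟩ := htf a
      by_cases htF : t ∈ F₁
      · -- (2a) a member of `F₁` avoiding `a`: a second minimal member with a different class
        have hat : a ∉ t := fun h => htiff ⟨fun _ => h, fun _ => htF⟩
        obtain ⟨m₂, hm₂, hm₂t, hmin₂⟩ := exists_minimal_subset_of_mem htF
        obtain ⟨a₂, ha₂⟩ := hI m₂ hm₂ hmin₂
        by_cases hsingle₂ : m₂ \ Rstar G = cls G a₂
        · have ham₂ : a ∉ m₂ := fun h => hat (hm₂t h)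
          have ha₂m : a₂ ∉ m := by
            intro h
            have h1 : a₂ ∈ m \ Rstar G := mem_sdiff.2 ⟨h, (mem_sdiff.1 ha₂).2⟩
            rw [hsingle] at h1
            have h2 : a ∈ cls G a₂ := mem_cls.2 (mem_cls.1 h1).symm
            rw [← hsingle₂] at h2
            exact ham₂ (mem_sdiff.1 h2).1
          refine ⟨m₂ \ m, collision_of_minimal_cls hG hsub hm hmin hsingle hm₂ ham₂,
            m \ m₂, collision_of_minimal_cls hG hsub hm₂ hmin₂ hsingle₂ hm ha₂m, ?_⟩
          intro h
          have h1 : a ∈ m \ m₂ := mem_sdiff.2 ⟨(mem_sdiff.1 ha).1, ham₂⟩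
          rw [← h] at h1
          exact ham₂ (mem_sdiff.1 h1).1
        · exact exists_two_collisions_of_not_cls hG hsub hm₂ hmin₂ ha₂ hsingle₂
      · -- (2b) a member of `F₀` containing `a`: go to a maximal member `s` above it
        have hat : a ∈ t := by
          by_contra h
          exact htiff ⟨fun h' => absurd h' htF, fun h' => absurd h' h⟩
        obtain ⟨s, hsG, hsF, hts, hmax⟩ := exists_maximal_superset_of_mem htG htF
        have has : a ∈ s := hts hat
        have hsy : (Rstar G \ s).Nonempty := by
          rw [Finset.nonempty_iff_ne_empty]
          intro h0
          rw [sdiff_eq_empty_iff_subset] at h0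
          have hms : m ⊆ s := by
            intro x hx
            by_cases hxM : x ∈ Rstar G
            · exact h0 hxM
            · have h1 : x ∈ m \ Rstar G := mem_sdiff.2 ⟨hx, hxM⟩
              rw [hsingle] at h1
              exact cls_subset_of_mem hsG has h1
          exact hsF (hup m hm s hsG hms)
        obtain ⟨b, hb⟩ := hsy
        by_cases hsingleb : Rstar G \ s = cls G b
        · have hE₁ : m \ s ∈ (F₁ \\ (G \ F₁)) ∩ ((G \ F₁) \\ G ∪ G \\ F₁) :=
            collision_of_minimal_of_inter_sdiff_Rstar_nonempty hG hsub hm hmin hsG hsF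
              ⟨a, mem_sdiff.2 ⟨mem_inter.2 ⟨(mem_sdiff.1 ha).1, has⟩, (mem_sdiff.1 ha).2⟩⟩
          have hbs : b ∉ s := (mem_sdiff.1 hb).2
          -- `b ∈ m \ s`: the collision is nonempty and lies inside the class of `b`
          have hbE : b ∈ m \ s := by
            obtain ⟨x, hx⟩ := nonempty_of_mem_collisions hup hE₁
            have hxM : x ∈ Rstar G := by
              by_contra hxM
              have h1 : x ∈ m \ Rstar G := mem_sdiff.2 ⟨(mem_sdiff.1 hx).1, hxM⟩
              rw [hsingle] at h1
              exact (mem_sdiff.1 hx).2 (cls_subset_of_mem hsG has h1)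
            have hxcls : x ∈ cls G b := by
              rw [← hsingleb]
              exact mem_sdiff.2 ⟨hxM, (mem_sdiff.1 hx).2⟩
            have hbm : b ∈ m := ((mem_cls.1 hxcls) m (hsub hm)).2 (mem_sdiff.1 hx).1
            exact mem_sdiff.2 ⟨hbm, hbs⟩
          obtain ⟨t', ht'G, ht'iff⟩ := htf b
          by_cases ht'F : t' ∈ F₁
          · have hbt' : b ∉ t' := fun h => ht'iff ⟨fun _ => h, fun _ => ht'F⟩
            refine ⟨m \ s, hE₁, t' \ s,
              collision_of_maximal_of_Rstar_sdiff_union_nonempty hsub hup hsG hsF hmax ht'F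
                ⟨b, mem_sdiff.2 ⟨(mem_sdiff.1 hb).1,
                  fun h => (mem_union.1 h).elim hbs hbt'⟩⟩, ?_⟩
            intro h
            rw [h] at hbE
            exact hbt' (mem_sdiff.1 hbE).1
          · have hbt' : b ∈ t' := by
              by_contra h
              exact ht'iff ⟨fun h' => absurd h' ht'F, fun h' => absurd h' h⟩
            refine ⟨m \ s, hE₁, (s ∪ cls G b) \ t',
              collision_of_maximal_cls hsG hsF hmax hsingleb ht'G ht'F hbt', ?_⟩
            intro h
            rw [h] at hbE
            exact (mem_sdiff.1 hbE).2 hbt'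
        · exact exists_two_collisions_of_not_cls' hsub hup hsG hsF hmax hb hsingleb
    · exact exists_two_collisions_of_not_cls hG hsub hm hmin ha hsingle
  · -- Case II: some ⊆-minimal member of `F₁` lies inside the addable part
    obtain ⟨m₀, hm₀, -, hm₀M⟩ : ∃ m₀ ∈ F₁, (∀ t ∈ F₁, t ⊆ m₀ → t = m₀) ∧
        ¬ (m₀ \ Rstar G).Nonempty := by
      by_contra h
      exact hI fun m hm hmin => by_contra fun hne => h ⟨m, hm, hmin, hne⟩
    have hm₀M' : m₀ ⊆ Rstar G :=
      sdiff_eq_empty_iff_subset.1 (Finset.not_nonempty_iff_eq_empty.1 hm₀M)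
    -- hence every ⊆-maximal member of `F₀` misses part of the addable part
    have hII : ∀ s ∈ G, s ∉ F₁ → (Rstar G \ s).Nonempty := by
      intro s hsG hsF
      rw [Finset.nonempty_iff_ne_empty]
      intro h0
      rw [sdiff_eq_empty_iff_subset] at h0
      exact hsF (hup m₀ hm₀ s hsG (hm₀M'.trans h0))
    obtain ⟨t₀, ht₀⟩ := hne₀
    obtain ⟨s, hsG, hsF, -, hmax⟩ :=
      exists_maximal_superset_of_mem (mem_sdiff.1 ht₀).1 (mem_sdiff.1 ht₀).2
    obtain ⟨b, hb⟩ := hII s hsG hsF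
    by_cases hsingleb : Rstar G \ s = cls G b
    · obtain ⟨t, htG, htiff⟩ := htf b
      by_cases htF : t ∈ F₁
      · -- (2b′) a member of `F₁` avoiding `b`: a minimal member below it
        have hbt : b ∉ t := fun h => htiff ⟨fun _ => h, fun _ => htF⟩
        have hbs : b ∉ s := (mem_sdiff.1 hb).2
        obtain ⟨m, hm, hmt, hmin⟩ := exists_minimal_subset_of_mem htF
        have hbm : b ∉ m := fun h => hbt (hmt h)
        have hmx : (m \ Rstar G).Nonempty := by
          rw [Finset.nonempty_iff_ne_empty]
          intro h0
          rw [sdiff_eq_empty_iff_subset] at h0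
          have hms : m ⊆ s := by
            intro x hx
            by_contra hxs
            have h1 : x ∈ Rstar G \ s := mem_sdiff.2 ⟨h0 hx, hxs⟩
            rw [hsingleb] at h1
            exact hbm (((mem_cls.1 h1) m (hsub hm)).2 hx)
          exact hsF (hup m hm s hsG hms)
        obtain ⟨a, ha⟩ := hmx
        by_cases hsingle : m \ Rstar G = cls G a
        · have hE₁ : m \ s ∈ (F₁ \\ (G \ F₁)) ∩ ((G \ F₁) \\ G ∪ G \\ F₁) :=
            collision_of_maximal_of_Rstar_sdiff_union_nonempty hsub hup hsG hsF hmax hm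
              ⟨b, mem_sdiff.2 ⟨(mem_sdiff.1 hb).1, fun h => (mem_union.1 h).elim hbs hbm⟩⟩
          -- `a ∈ m \ s`
          have haE : a ∈ m \ s := by
            obtain ⟨x, hx⟩ := nonempty_of_mem_collisions hup hE₁
            have hxM : x ∉ Rstar G := by
              intro hxM
              have h1 : x ∈ Rstar G \ s := mem_sdiff.2 ⟨hxM, (mem_sdiff.1 hx).2⟩
              rw [hsingleb] at h1
              exact hbm (((mem_cls.1 h1) m (hsub hm)).2 (mem_sdiff.1 hx).1)
            have hxcls : x ∈ cls G a := by
              rw [← hsingle]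
              exact mem_sdiff.2 ⟨(mem_sdiff.1 hx).1, hxM⟩
            have has : a ∉ s := fun h => (mem_sdiff.1 hx).2 (((mem_cls.1 hxcls) s hsG).1 h)
            exact mem_sdiff.2 ⟨(mem_sdiff.1 ha).1, has⟩
          obtain ⟨t', ht'G, ht'iff⟩ := htf a
          by_cases ht'F : t' ∈ F₁
          · have hat' : a ∉ t' := fun h => ht'iff ⟨fun _ => h, fun _ => ht'F⟩
            refine ⟨m \ s, hE₁, t' \ m,
              collision_of_minimal_cls hG hsub hm hmin hsingle ht'F hat', ?_⟩
            intro h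
            rw [h] at haE
            exact hat' (mem_sdiff.1 haE).1
          · have hat' : a ∈ t' := by
              by_contra h
              exact ht'iff ⟨fun h' => absurd h' ht'F, fun h' => absurd h' h⟩
            refine ⟨m \ s, hE₁, m \ t',
              collision_of_minimal_of_inter_sdiff_Rstar_nonempty hG hsub hm hmin ht'G ht'F
                ⟨a, mem_sdiff.2 ⟨mem_inter.2 ⟨(mem_sdiff.1 ha).1, hat'⟩, (mem_sdiff.1 ha).2⟩⟩, ?_⟩
            intro h
            rw [h] at haE
            exact (mem_sdiff.1 haE).2 hat'
        · exact exists_two_collisions_of_not_cls hG hsub hm hmin ha hsingle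
      · -- (2a′) a member of `F₀` containing `b`: a second maximal member with a different class
        have hbt : b ∈ t := by
          by_contra h
          exact htiff ⟨fun h' => absurd h' htF, fun h' => absurd h' h⟩
        obtain ⟨s₂, hs₂G, hs₂F, hts₂, hmax₂⟩ := exists_maximal_superset_of_mem htG htF
        have hbs₂ : b ∈ s₂ := hts₂ hbt
        obtain ⟨b₂, hb₂⟩ := hII s₂ hs₂G hs₂F
        by_cases hsingle₂ : Rstar G \ s₂ = cls G b₂
        · have hb₂s : b₂ ∈ s := by
            by_contra h
            have h1 : b₂ ∈ Rstar G \ s := mem_sdiff.2 ⟨(mem_sdiff.1 hb₂).1, h⟩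
            rw [hsingleb] at h1
            have h2 : b ∈ cls G b₂ := mem_cls.2 (mem_cls.1 h1).symm
            rw [← hsingle₂] at h2
            exact (mem_sdiff.1 h2).2 hbs₂
          refine ⟨(s ∪ cls G b) \ s₂, collision_of_maximal_cls hsG hsF hmax hsingleb hs₂G hs₂F hbs₂,
            (s₂ ∪ cls G b₂) \ s, collision_of_maximal_cls hs₂G hs₂F hmax₂ hsingle₂ hsG hsF hb₂s, ?_⟩
          intro h
          have h1 : b ∈ (s₂ ∪ cls G b₂) \ s :=
            mem_sdiff.2 ⟨mem_union.2 (Or.inl hbs₂), (mem_sdiff.1 hb).2⟩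
          rw [← h] at h1
          exact (mem_sdiff.1 h1).2 hbs₂
        · exact exists_two_collisions_of_not_cls' hsub hup hs₂G hs₂F hmax₂ hb₂ hsingle₂
    · exact exists_two_collisions_of_not_cls' hsub hup hsG hsF hmax hb hsingleb

/-- **Lemma A⁺.** A tight family `G` with a nonempty proper up-set `F₁` of members such that, for
no element `a`, `F₁` is exactly the set of members containing `a`, has at least two collisions:
differences realised both by a pair `(t ∈ F₁, s ∉ F₁)` and by a pair not of that type. -/
theorem two_le_card_collisions (hG : Tight G) (hsub : F₁ ⊆ G) (hne₁ : F₁.Nonempty)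
    (hne₀ : (G \ F₁).Nonempty) (hup : ∀ t ∈ F₁, ∀ s ∈ G, t ⊆ s → s ∈ F₁)
    (htf : ∀ a : α, ∃ t ∈ G, ¬ (t ∈ F₁ ↔ a ∈ t)) : 2 ≤ ((F₁ \\ (G \ F₁)) ∩ ((G \ F₁) \\ G ∪ G \\ F₁)).card := by
  obtain ⟨E₁, hE₁, E₂, hE₂, hne⟩ := exists_two_collisions hG hsub hne₁ hne₀ hup htf
  have hpair : ({E₁, E₂} : Finset (Finset α)) ⊆ (F₁ \\ (G \ F₁)) ∩ ((G \ F₁) \\ G ∪ G \\ F₁) := by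
    intro E hE
    rcases mem_insert.1 hE with rfl | hE
    · exact hE₁
    · rw [mem_singleton.1 hE]
      exact hE₂
  have := card_le_card hpair
  rwa [card_pair hne] at this


end Tight

end PercRepro.MSTight
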